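import Summits.QuantumFields.YangMills.Theorems.FradkinShenkerFlowFiniteSusceptibilityWeakCouplingMirrorFunnel
import Summits.QuantumFields.YangMills.Theorems.FradkinShenkerFlowFiniteSusceptibilityWeakCouplingMirrorPositivity
import Summits.QuantumFields.YangMills.Theorems.FradkinShenkerFlowFiniteSusceptibilityWeakCouplingMirrorMonotone
import Summits.QuantumFields.YangMills.Theorems.FradkinShenkerFlowFiniteSusceptibilityWeakCouplingPlaquetteCharacterOnset
import Summits.QuantumFields.YangMills.Theorems.FradkinShenkerFlowFiniteSusceptibilityWeakCouplingSpeciesParity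
import Summits.QuantumFields.YangMills.Theorems.FradkinShenkerFlowFiniteSusceptibilityWeakCouplingEvenSplit
import Summits.QuantumFields.YangMills.Theorems.FradkinShenkerFlowFiniteSusceptibilityWeakCouplingAxisParity
import Summits.QuantumFields.YangMills.Theorems.FradkinShenkerFlowFiniteSusceptibilityWeakCouplingAutSectorClause
import Summits.QuantumFields.YangMills.Theorems.FradkinShenkerFlowFiniteSusceptibilityWeakCouplingSU2ConjugationEven
import HarnessLib

/-!
# Line `purity-rate-split` — skeleton for crux `stmt-QuantumFields-9442`
(`Summit.QuantumFields.YangMills.Theses.FradkinShenkerFlow.FiniteSusceptibilityWeakCoupling`)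

Crux-strategist line (wall-breaker generation 1, 2026-08-17). NOT a funnel to `C⁺`: the crux is cut along the
refuters' kill-shape taxonomy (Disproof.lean §"Why it resists"; TRIAGE-r1-1 §B, TRIAGE-r1-2: a failure of finite
susceptibility at weak coupling is either (0) a ZERO-RATE failure — long-range order / phase coexistence at
couplings accumulating at `β = ∞`, spontaneous breaking of a lattice symmetry, a torus-scale thermal floor — or
(1) a RATE failure — correlations that tend to zero too slowly to be summable in `d = 4`, i.e. a gauge-invariant
infrared field of dimension `≤ 2` (emergent photon, light scalar), which is exactly the `U(1)₄` mechanism) into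

* STUB 0 `stub_noMirrorLongRangeOrder` = `NoMirrorLongRangeOrder` (the PURITY half, zero-rate): at every
  `β ≥ β₀(G,r)` every gauge-invariant local observable `A` decorrelates from its own time-reflected image
  `A ∘ Θ` along the time axis, UNIFORMLY in the odd tori carrying the lag (`j ≤ S`). Each such term is
  `≥ 0` beyond the support scale (`MirrorPositivity.mirrorCorr_nonneg_eventually`), so this is literally
  "no species has long-range order against its mirror image" — an order-parameter statement, group-blind
  (it holds in the `U(1)₄` Coulomb phase), implied by every lattice-gap leg and (informally, monotone mirror
  functions) by the crux itself;
* STUB 1 `stub_decorrelationForcesSummability` = `DecorrelationForcesSummability` (the RATE half): at every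
  `β ≥ β₀(G,r)`, IF all pairs decorrelate uniformly in the volume THEN the crux's susceptibility clause holds at
  `β` — a weak-coupling dichotomy "mixing ⇒ finite susceptibility". FALSE with simplicity deleted (`U(1)₄`), so it
  carries the whole load of `IsCompactSimpleLieGroup`; its hypothesis removes precisely the `Δ = 0` / coexistence
  hole on which card `unitarity-window-inversion` failed triage.

Composition (kernel-checked, §4): STUB 0 ⇒ (all pairs decorrelate, by the landed explicit-pair mirror domination
`MirrorFunnel.abs_cov_axial_le_mirror`, proved here as `decorrelation_of_mirrorDecorrelation`, `β ≥ 0`) ⇒ STUB 1's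
hypothesis ⇒ the crux's clause; `β₀ := max β₀⁰ (max β₀¹ 0)`. `FiniteSusceptibilityWeakCoupling_of` concludes the crux
BY NAME with `sorry` entering only through the two registered stubs. Both stubs are OPEN (sub-crux-sized): this line
is the typed carrier of the strategist's DECOMPOSITION (children `NoMirrorLongRangeOrder`, `DecorrelationForcesSummability`;
`route edit --split` is reserved to a final cycle, so the lead is asked to `promote-stub` both and to land the
sorry-free conditional file `Cruxes/FiniteSusceptibilityWeakCoupling/Split.lean` as
`Theorems/FradkinShenkerFlowFiniteSusceptibilityWeakCouplingSplit.lean`). Line card: `Lines/purity-rate-split.md`;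
census: `STRATEGY-CENSUS.md`.

**Lead c16 (2026-08-17).** The decomposition glue is landed (`Theorems/…Split.lean`, p137292) and the converse
`crux ⇒ STUB 0` is PROVED (`Theorems/…MirrorLogConvex.lean` p137813 + `Theorems/…MirrorMonotone.lean` p138297: odd-torus RP
makes the mirror correlator non-negative and step-one log-convex, the symmetrised mirror function is therefore monotone, and
the susceptibility clause forces it to zero uniformly in the volume). §6 records the consequence inside the line: the two
registered stubs are together EQUIVALENT to the crux (`crux_iff_stubs`), so promoting them loses nothing.

**Lead c18 (2026-08-17).** Where `IsCompactSimpleLieGroup` enters STUB 1 is now typed and LANDED (§7): three registered helper stubs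
under `Theorems/` — `stub_simpleRepDetOne` (p140546: no continuous character, `det ∘ r.ρ ≡ 1`), `stub_oddTraceActionBound`
(p140993: on `SU(N)`, `|Im tr V| ≤ C_N (N - Re tr V)^{3/2}`) and their composition in the route's vocabulary
`stub_plaquetteCharacterOnset` (p141395), with the group-blind even identity `plaquette_frobenius_sq`. The sorry count is unchanged
(2 = STUB 0 + STUB 1, both open-problem-sized and promoted; children not yet filed as items).

**Lead c20 (2026-08-17) — RESHAPE: STUB 0 is reduced to the reflection-EVEN sector ("lattice Vafa–Witten").** For every
compact `G` and every `β ≥ 0` (no simplicity, no weak coupling): a reflection-ODD species `A ∘ Θ = −A` NEVER has mirror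
long-range order — its mirror correlator is minus its axial autocorrelation, which is `≤ 0` on the reflection-positive lags
(landed `MirrorLogConvex.mirrorCorr_nonneg`) while the axial sum `Σ_{t<L} Cov_S(A, τ_t A) = Var_S(Σ_t τ_t A)/L ≥ 0` (torus
translation invariance; new stub `stub_axialSusceptibilityNonneg`), so `Σ_{t ≤ S} |D_A(t)| ≤ C(A)` uniformly in `S` and the
c16 monotonicity argument (new stub `stub_mirrorDecorrelationOfAxialSums`, the FS-clause-free core of
`MirrorMonotone.mirrorDecorrelation_of_fsClause`) gives uniform decay (new stub `stub_oddSpeciesNoMirrorLRO`); for a general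
species `A = ½(A⁺ + A⁻)` the odd part and the odd/even cross terms die (RP Cauchy–Schwarz, landed
`MirrorFunnel.abs_cov_axial_le_mirror`; new stub `stub_noMirrorLRO_of_even`), so STUB 0 for `A` follows from the plain
time-axis decorrelation of its EVEN part `A⁺ = A + A∘Θ` (`SpeciesParity.symSpecies`, landed p144906). The registered purity stub is therefore now
`stub_noEvenLongRangeOrder` (STUB 0′: at weak coupling no reflection-EVEN species has long-range order along the time axis,
uniformly in the odd tori) — strictly weaker than the old `stub_noMirrorLongRangeOrder`, which §4′ DERIVES from STUB 0′ and
the four new stubs; `crux ⟺ STUB 0′ ∧ STUB 1` stays kernel-checked (§6). Stubs: OPEN `stub_noEvenLongRangeOrder`,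
`stub_decorrelationForcesSummability` (the two `sorry`s of this file); LANDED this seat under `Theorems/` (`--supports stmt-QuantumFields-9442`)
`stub_axialSusceptibilityNonneg` (p143199), `stub_mirrorDecorrelationOfAxialSums` (p143147), `stub_oddSpeciesNoMirrorLRO` (p143579),
`stub_noMirrorLRO_of_even` (p143892) — §1 points at them, so STUB 0′ ⇒ STUB 0 (§4′) and `crux ⟺ STUB 0′ ∧ STUB 1` (§6) hold with no `sorry`
beyond the two open stubs.

**Lead c21 (2026-08-17) — the two registered stubs ARE NOW ITEMS; the purity stub is cut along the spatial axis reflections.** The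
crux-strategist (generation 2) filed STUB 0′ and STUB 1 verbatim as crux items stmt-QuantumFields-18060 `NoEvenLongRangeOrder` and
stmt-QuantumFields-18061 `DecorrelationForcesSummability` on the route, so this skeleton closes the crux modulo two EXISTING items (its two
`sorry`s), and the curried glue the strategist asked for is landed (`…EvenSplit.lean`: `finiteSusceptibilityWeakCoupling_of_even_subs`,
registered `stub_cruxOfEvenSubs`). New content (§8, strategist §D5, one wave of four stub-workers + the lead, all landed
`--supports stmt-QuantumFields-9442`, every compact `G`, every real `β`): the spatial axis reflections `θ₁, θ₂, θ₃` of `ℤ⁴` gauge fields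
commute with `Θ` and with each other (`stub_axisReflectionsCommute`), leave the torus Wilson state invariant and commute with time
translations, so `θ_k`-even ⊥ `θ_k`-odd in the connected time correlator (`stub_spatialReflectionSelectionRule`) and
`4·c_A = c_{A+A∘θ_k} + c_{A−A∘θ_k}` (`stub_connectedCorrPolarisation`, `AxisParity.four_mul_autocorr_eq`); a `θ_k`-odd species is
`β`-uniformly `ℓ¹` along its own axis (`stub_axisOddSpeciesSummable`, spatial lattice Vafa–Witten); hence
**STUB 0′ ⟺ NoAxisEvenLRO ∧ EvenOddDirectionTransfer** (`stub_noEvenLRO_iff_axisParity`): the purity child lives in the sector even under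
ALL FOUR axis reflections, plus the direction-blindness of long-range order for `Θ`-even, `θ_k`-odd observables. Sorry count unchanged (2).

**Lead c22 (2026-08-17) — STUB 1 RE-TYPED (same proposition), registration repaired.** The registered text of
`stub_decorrelationForcesSummability` had been truncated by the skeleton-check parser at the first `:=` token, i.e. inside the
named argument `wilsonMeasure (d := 4) (L := 2 * S + 1) r.ρ β` (c21 HARNESS NOTE; the operator's variants file p145681 on the
truncated text failed to parse, and the c22 payload flagged the stub as "mis-typed / self-implied"). §1 now spells the Wilson
measure `wilsonMeasure r.ρ β` (implicit `d`, `L` inferred from the covariance's configuration space `GaugeConfig 4 (2S+1) G`):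
the signature contains no `:=`, elaborates to the IDENTICAL term (§1 `retypedStub1_iff_item18061 := Iff.rfl` against item
stmt-QuantumFields-18061 verbatim, so `exact h18061` closes the stub when the item lands), and is not self-implied
(`intros; assumption` fails: hypothesis = uniform time-axis decorrelation in `latticeConnectedCorr` vocabulary, conclusion = the
crux's susceptibility clause in `covariance` vocabulary). Stubs, composition (§4) and sorry count (2 = items 18060 / 18061) unchanged.

**Lead c23 (2026-08-17) — STUB 1 RENAMED (same proposition): `stub_decorrelationForcesSummability` ↦
`stub_rateHalfDecorrelationForcesSummability`.** The c23 payload flagged the OLD name again as "mis-typed / self-implied"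
although the c22 registration is complete and `:=`-free: the flag is keyed on the off-box hammer record for the pair
(item, stub NAME), made from the pre-c22 TRUNCATED registration (its "proof" landed nowhere — p145681 BOUNCED 06:58Z with a parse
error), and the hub-visible headline `run/shared/lean/ttrl/stmt-QuantumFields-9442/LIBRARY.md` (08:04Z) predates the c22 repair
(10:02Z). A hammer record is never re-attempted for the same (item, stub) key, so the only lead-side way to retire the stale flag is
to retire the NAME: the rate-half stub is re-registered under a new name with the IDENTICAL statement (item stmt-QuantumFields-18061
verbatim up to the spelling of the Wilson measure, `retypedStub1_iff_item18061 := Iff.rfl`), the old registration expires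
("replaced by skeleton"), and the hammer meets the complete statement under the new key. Nothing else changes: stubs = {STUB 0′
`stub_noEvenLongRangeOrder` = item 18060, STUB 1 `stub_rateHalfDecorrelationForcesSummability` = item 18061}, composition §4, sorry
count 2, `crux ⟺ STUB 0′ ∧ STUB 1` (§6).

**Lead c28 (2026-08-17) — the CHARGE-CONJUGATION / automorphism sector is typed and cut (§9); stubs unchanged.** Four files
landed under `Theorems/` (`--supports stmt-QuantumFields-9442`, each with a registered stub; every compact `G`, every real `β`
unless stated): `…SU2ConjugationEven` (`stub_su2SpeciesConjEven`: complex conjugation of all links is the global gauge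
transformation by `iσ₂ ∈ SU(2)`, so EVERY species of `SU(2)` lattice gauge theory is `C`-even — the `C`-odd sector that carries
the `U(1)₄` counter-mechanism of STUB 1 is EMPTY for `SU(2)`), `…AutomorphismSector` (`stub_automorphismSelectionRule`: a
bi-continuous automorphism `φ` of `G` preserving the Wilson character `Re tr r.ρ` leaves the torus Wilson state invariant when
applied link-wise — Haar uniqueness —, so `φ`-even ⊥ `φ`-odd in `latticeConnectedCorr`; involutive polarisation
`4·K(A,A) = K(A+A∘φ, A+A∘φ) + K(A−A∘φ, A−A∘φ)`; `SU(N)` entrywise conjugation IS such a `φ`, `AutSector.exists_suConj`),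
`…AutParity` (`stub_evenClause_iff_autParity`: STUB 0′'s clause at fixed `(G, r, β)` ⟺ its restrictions to the `φ`-even and to
the `φ`-odd `Θ`-even species) and `…AutSectorClause` (`stub_fsClause_iff_autParity`: the CRUX's inner clause — and STUB 1's
conclusion — at fixed `(G, r, β)` ⟺ its restrictions to the `(φ-even, φ-even)` and `(φ-odd, φ-odd)` pairs; covariance-form
selection rule in every lattice direction on every torus). This is the `C`-conjunct of STRATEGY-CENSUS §S⁺8 / §N9(c) / §N10 made
kernel bookkeeping; no engine; sorry count 2 (= items 18060 / 18061).
-/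

set_option autoImplicit false

noncomputable section

open MeasureTheory ProbabilityTheory Finset
open scoped BigOperators
open Literature.MathematicalPhysics.QuantumFieldTheory hiding Site ZdEdge
open Literature.MathematicalPhysics.QuantumLattice
open Literature.Probability.LatticeModels hiding configShift configShift_apply

namespace Summit.QuantumFields.YangMills.Cruxes.FiniteSusceptibilityWeakCoupling.PurityRateSplit

/-! ## §0 The statements (short names) -/

section Clauses

variable {G : Type} [Group G] [TopologicalSpace G] [IsTopologicalGroup G] [CompactSpace G]
  [MeasurableSpace G] [BorelSpace G]

/-- Time-axis decorrelation of the reflection-EVEN species at fixed `(G, r, β)` (STUB 0′ at `β`): the plain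
autocorrelation `⟨A · τ_{j e₀} A⟩ − ⟨A⟩²` of every species with `A ∘ Θ = A` tends to zero uniformly in the odd tori. [folklore] -/
def EvenDecorrelationAt (r : LatticeRep G) (β : ℝ) : Prop :=
  ∀ A : YMSpecies G, (∀ V, A.F (cfgReflect V) = A.F V) → ∀ ε : ℝ, 0 < ε → ∃ j₀ : ℕ, ∀ S j : ℕ, j₀ ≤ j → j ≤ S →
    |latticeConnectedCorr r.ρ β (2 * S + 1) A.F A.F j| ≤ ε

/-- Mirror decorrelation at fixed `(G, r, β)`: every species decorrelates from its own time-reflected image,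
uniformly in the odd tori carrying the lag. [folklore] -/
def MirrorDecorrelationAt (r : LatticeRep G) (β : ℝ) : Prop :=
  ∀ A : YMSpecies G, ∀ ε : ℝ, 0 < ε → ∃ j₀ : ℕ, ∀ S j : ℕ, j₀ ≤ j → j ≤ S →
    |latticeConnectedCorr r.ρ β (2 * S + 1) A.F (fun V => A.F (cfgReflect V)) j| ≤ ε

/-- All-pairs decorrelation at fixed `(G, r, β)` (the hypothesis of STUB 1 at `β`). [folklore] -/
def DecorrelationAt (r : LatticeRep G) (β : ℝ) : Prop :=
  ∀ A B : YMSpecies G, ∀ ε : ℝ, 0 < ε → ∃ n₀ : ℕ, ∀ S n : ℕ, n₀ ≤ n → n ≤ S →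
    |latticeConnectedCorr r.ρ β (2 * S + 1) A.F B.F n| ≤ ε

/-- The crux's inner clause at fixed `(G, r, β)` (= `Disproof.FSClause G r.ρ β`). [folklore] -/
def FSClauseAt (r : LatticeRep G) (β : ℝ) : Prop :=
  ∀ A B : YMSpecies G, ∃ χ : ℝ, ∀ S : ℕ,
    ∑ x ∈ box 4 S, |cov[fun U => A.F (torusLift (2 * S + 1) U),
      fun U => B.F (configShift (-x) (torusLift (2 * S + 1) U));
      wilsonMeasure (d := 4) (L := 2 * S + 1) r.ρ β]| ≤ χ

end Clauses

/-- STUB 0 statement — **no mirror long-range order at weak coupling** (the purity half). -/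
def NoMirrorLongRangeOrder : Prop :=
  ∀ (G : Type) [Group G] [TopologicalSpace G] [IsTopologicalGroup G] [CompactSpace G]
    [MeasurableSpace G] [BorelSpace G], IsCompactSimpleLieGroup G → ∀ r : LatticeRep G,
    ∃ β₀ : ℝ, ∀ β : ℝ, β₀ ≤ β → MirrorDecorrelationAt r β

/-- STUB 0′ statement (lead c20) — **no long-range order in the reflection-EVEN sector at weak coupling**. -/
def NoEvenLongRangeOrder : Prop :=
  ∀ (G : Type) [Group G] [TopologicalSpace G] [IsTopologicalGroup G] [CompactSpace G]
    [MeasurableSpace G] [BorelSpace G], IsCompactSimpleLieGroup G → ∀ r : LatticeRep G,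
    ∃ β₀ : ℝ, ∀ β : ℝ, β₀ ≤ β → EvenDecorrelationAt r β

/-- STUB 1 statement — **decorrelation forces summability at weak coupling** (the rate half). -/
def DecorrelationForcesSummability : Prop :=
  ∀ (G : Type) [Group G] [TopologicalSpace G] [IsTopologicalGroup G] [CompactSpace G]
    [MeasurableSpace G] [BorelSpace G], IsCompactSimpleLieGroup G → ∀ r : LatticeRep G,
    ∃ β₀ : ℝ, ∀ β : ℝ, β₀ ≤ β → DecorrelationAt r β → FSClauseAt r β

/-! ## §1 The registered stubs (signatures fully qualified, verbatim the intended sub-crux statements) -/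

/-- STUB 0′ (registered `stub_noEvenLongRangeOrder`, lead c20 reshape of `stub_noMirrorLongRangeOrder`; OPEN, sub-crux-sized,
zero-rate): for compact simple `G` and faithful unitary `r` there is `β₀` such that at every `β ≥ β₀` every reflection-EVEN
gauge-invariant local observable (`A ∘ Θ = A`) decorrelates from ITSELF along the time axis, uniformly in the odd tori
(`j ≤ S`). For even `A` the plain autocorrelation IS the mirror correlator (non-negative and non-increasing in `j` beyond
the support scale, by RP), so this is "no long-range order in the even sector"; the odd sector is a THEOREM
(`stub_oddSpeciesNoMirrorLRO`) and the old STUB 0 follows (§4′). Enemies: coexistence at `β → ∞`, spontaneous breaking of a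
Θ-even order parameter, a torus-scale floor. Group-blind: holds for `U(1)₄`. -/
theorem stub_noEvenLongRangeOrder : ∀ (G : Type) [Group G] [TopologicalSpace G] [IsTopologicalGroup G] [CompactSpace G] [MeasurableSpace G] [BorelSpace G], Literature.MathematicalPhysics.QuantumFieldTheory.IsCompactSimpleLieGroup G → ∀ r : Literature.MathematicalPhysics.QuantumFieldTheory.LatticeRep G, ∃ β₀ : ℝ, ∀ β : ℝ, β₀ ≤ β → ∀ A : Literature.MathematicalPhysics.QuantumFieldTheory.YMSpecies G, (∀ V, A.F (Literature.MathematicalPhysics.QuantumFieldTheory.cfgReflect V) = A.F V) → ∀ ε : ℝ, 0 < ε → ∃ j₀ : ℕ, ∀ S j : ℕ, j₀ ≤ j → j ≤ S → |Literature.MathematicalPhysics.QuantumFieldTheory.latticeConnectedCorr r.ρ β (2 * S + 1) A.F A.F j| ≤ ε := by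
  sorry

/-- NEW STUB (c20, group-blind, every `β`) `stub_axialSusceptibilityNonneg` — LANDED p143199 (`Theorems/…AxialSusceptibility.lean`,
stub-worker W1 of lead c20) — **the axial susceptibility of a species on a torus is non-negative**: `Σ_{t < 2S+1} (⟨A · τ_{t e₀} A⟩_{β,2S+1} − ⟨A⟩²) = Var(Σ_t A∘τ_{t e₀})/(2S+1) ≥ 0` (translation
invariance of the torus Wilson state along the time axis; covariance of the axial sum with itself). [folklore] -/
theorem stub_axialSusceptibilityNonneg : ∀ (G : Type) [Group G] [TopologicalSpace G] [IsTopologicalGroup G] [CompactSpace G] [MeasurableSpace G] [BorelSpace G] (r : Literature.MathematicalPhysics.QuantumFieldTheory.LatticeRep G) (β : ℝ) (A : Literature.MathematicalPhysics.QuantumFieldTheory.YMSpecies G) (S : ℕ), 0 ≤ ∑ n ∈ Finset.range (2 * S + 1), Literature.MathematicalPhysics.QuantumFieldTheory.latticeConnectedCorr r.ρ β (2 * S + 1) A.F A.F n :=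
  Summit.QuantumFields.YangMills.Theorems.FiniteSusceptibilityWeakCoupling.stub_axialSusceptibilityNonneg

/-- NEW STUB (c20, group-blind, `β ≥ 0`) `stub_mirrorDecorrelationOfAxialSums` — LANDED p143147 (`Theorems/…AxialSumsDecorrelation.lean`,
stub-worker W2 of lead c20) — **uniformly bounded axial ℓ¹ norms of the mirror correlator and of the swapped correlator force
mirror decorrelation**: the FS-clause-free core of the landed
`MirrorMonotone.mirrorDecorrelation_of_fsClause` (which used the crux's clause only through these two axial sums): the
symmetrised mirror function is non-negative, step-one log-convex and symmetric about `L/2` (RP, `MirrorLogConvex`), hence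
non-increasing on `[2R+1, S]`, so `(j − 2R)·D_A(j) ≤ 2χ`. [folklore] -/
theorem stub_mirrorDecorrelationOfAxialSums : ∀ (G : Type) [Group G] [TopologicalSpace G] [IsTopologicalGroup G] [CompactSpace G] [MeasurableSpace G] [BorelSpace G] (r : Literature.MathematicalPhysics.QuantumFieldTheory.LatticeRep G) (β : ℝ), 0 ≤ β → ∀ (A : Literature.MathematicalPhysics.QuantumFieldTheory.YMSpecies G) (χ : ℝ), (∀ S : ℕ, ∑ i ∈ Finset.range (S + 1), |Literature.MathematicalPhysics.QuantumFieldTheory.latticeConnectedCorr r.ρ β (2 * S + 1) A.F (fun V => A.F (Literature.MathematicalPhysics.QuantumFieldTheory.cfgReflect V)) i| ≤ χ) → (∀ S : ℕ, ∑ i ∈ Finset.range (S + 1), |Literature.MathematicalPhysics.QuantumFieldTheory.latticeConnectedCorr r.ρ β (2 * S + 1) (fun V => A.F (Literature.MathematicalPhysics.QuantumFieldTheory.cfgReflect V)) A.F i| ≤ χ) → ∀ ε : ℝ, 0 < ε → ∃ j₀ : ℕ, ∀ S j : ℕ, j₀ ≤ j → j ≤ S → |Literature.MathematicalPhysics.QuantumFieldTheory.latticeConnectedCorr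 r.ρ β (2 * S + 1) A.F (fun V => A.F (Literature.MathematicalPhysics.QuantumFieldTheory.cfgReflect V)) j| ≤ ε :=
  Summit.QuantumFields.YangMills.Theorems.FiniteSusceptibilityWeakCoupling.stub_mirrorDecorrelationOfAxialSums

/-- NEW STUB (c20, group-blind, `β ≥ 0`) `stub_oddSpeciesNoMirrorLRO` — LANDED p143579 (`Theorems/…OddSector.lean`, lead c20) —
**lattice Vafa–Witten: a reflection-ODD species never has mirror long-range order.** If `A ∘ Θ = −A` then `D_A(t) = −Cov_S(A, τ_t A)`; RP makes `D_A ≥ 0` on `[2R+1, 2S−2R]`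
(`MirrorLogConvex.mirrorCorr_nonneg`), the axial sum rule (`stub_axialSusceptibilityNonneg`) makes `Σ_{t<L} Cov_S(A, τ_t A) ≥ 0`,
so `Σ_{t ≤ 2S} |D_A(t)| ≤ 2(4R+1)·4‖A‖∞²` uniformly in `S`, and `stub_mirrorDecorrelationOfAxialSums` concludes. No
simplicity, no weak coupling: every `β ≥ 0`. [folklore] -/
theorem stub_oddSpeciesNoMirrorLRO : ∀ (G : Type) [Group G] [TopologicalSpace G] [IsTopologicalGroup G] [CompactSpace G] [MeasurableSpace G] [BorelSpace G] (r : Literature.MathematicalPhysics.QuantumFieldTheory.LatticeRep G) (β : ℝ), 0 ≤ β → ∀ A : Literature.MathematicalPhysics.QuantumFieldTheory.YMSpecies G, (∀ V, A.F (Literature.MathematicalPhysics.QuantumFieldTheory.cfgReflect V) = -A.F V) → ∀ ε : ℝ, 0 < ε → ∃ j₀ : ℕ, ∀ S j : ℕ, j₀ ≤ j → j ≤ S → |Literature.MathematicalPhysics.QuantumFieldTheory.latticeConnectedCorr r.ρ β (2 * S + 1) A.F (fun V => A.F (Literature.MathematicalPhysics.QuantumFieldTheory.cfgReflect V)) j|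 ≤ ε :=
  Summit.QuantumFields.YangMills.Theorems.FiniteSusceptibilityWeakCoupling.stub_oddSpeciesNoMirrorLRO

/-- NEW STUB (c20, group-blind, `β ≥ 0`) `stub_noMirrorLRO_of_even` — LANDED p143892 (`Theorems/…EvenReduction.lean`, lead c20) —
**STUB 0 reduces to the even sector.** If `P = A + A∘Θ` and
`M = A − A∘Θ` (as species) and the EVEN species `P` decorrelates from itself along the time axis uniformly in the odd tori, then
`A` has no mirror long-range order: `4·D_A = D_P + D_M + [Cov_S(M, τ P) − Cov_S(P, τ M)]`, `D_M → 0` by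
`stub_oddSpeciesNoMirrorLRO`, and the cross terms are dominated by a three-lag window of `|D_M| + |D_M| + |D_P|`
(`MirrorFunnel.abs_cov_axial_le_mirror`). [folklore] -/
theorem stub_noMirrorLRO_of_even : ∀ (G : Type) [Group G] [TopologicalSpace G] [IsTopologicalGroup G] [CompactSpace G] [MeasurableSpace G] [BorelSpace G] (r : Literature.MathematicalPhysics.QuantumFieldTheory.LatticeRep G) (β : ℝ), 0 ≤ β → ∀ A P M : Literature.MathematicalPhysics.QuantumFieldTheory.YMSpecies G, (∀ V, P.F V = A.F V + A.F (Literature.MathematicalPhysics.QuantumFieldTheory.cfgReflect V)) → (∀ V, M.F V = A.F V - A.F (Literature.MathematicalPhysics.QuantumFieldTheory.cfgReflect V)) → (∀ ε : ℝ, 0 < ε → ∃ j₀ : ℕ, ∀ S j : ℕ, j₀ ≤ j → j ≤ S → |Literature.MathematicalPhysics.QuantumFieldTheory.latticeConnectedCorr r.ρ β (2 * S + 1) P.F P.F j| ≤ ε) → ∀ ε : ℝ, 0 < ε → ∃ j₀ : ℕ, ∀ S j : ℕ, j₀ ≤ j → j ≤ S → |Literature.MathematicalPhysics.QuantumFieldTheory.latticeConnectedCorr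 r.ρ β (2 * S + 1) A.F (fun V => A.F (Literature.MathematicalPhysics.QuantumFieldTheory.cfgReflect V)) j| ≤ ε :=
  Summit.QuantumFields.YangMills.Theorems.FiniteSusceptibilityWeakCoupling.stub_noMirrorLRO_of_even

/-- STUB 1 (registered `stub_rateHalfDecorrelationForcesSummability` — lead c23 rename of `stub_decorrelationForcesSummability`,
SAME proposition = item stmt-QuantumFields-18061; OPEN, sub-crux-sized, carries the simplicity load): for
compact simple `G` and faithful unitary `r` there is `β₀` such that at every `β ≥ β₀`, uniform decorrelation of all
pairs implies the crux's susceptibility clause at `β`. False for `U(1)₄` (Coulomb phase decorrelates, `Σ|Cov| ~ log S`);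
entry point of simplicity: no invariant first chaos (`det ρ ≡ 1`, `SimpleRepDetOne`).

**Re-typed by lead c22 (2026-08-17), SAME proposition**: the Wilson measure is written `wilsonMeasure r.ρ β` with its
implicit `d = 4`, `L = 2 * S + 1` inferred from the covariance's configuration space instead of passed as named arguments;
the two spellings elaborate to the identical term (`work/RetypeCheck.lean`: `Iff.rfl` against item stmt-QuantumFields-18061
verbatim), so a proof `h : <18061>` closes this stub by `exact h`. Reason: the skeleton-check registration parser cuts a
stub signature at the first `:=` token, so every earlier registration of this stub was truncated inside the named argument
(HARNESS NOTE of c21; operator variants file p145681 failed to parse; the c22 payload flagged the truncated text as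
"mis-typed"). The statement is NOT self-implied: its hypothesis is uniform time-axis decorrelation in `latticeConnectedCorr`
vocabulary, its conclusion the crux's susceptibility clause in `covariance` vocabulary, and `intros; assumption` fails on it
(same scratch file). -/
theorem stub_rateHalfDecorrelationForcesSummability : ∀ (G : Type) [Group G] [TopologicalSpace G] [IsTopologicalGroup G] [CompactSpace G] [MeasurableSpace G] [BorelSpace G], Literature.MathematicalPhysics.QuantumFieldTheory.IsCompactSimpleLieGroup G → ∀ r : Literature.MathematicalPhysics.QuantumFieldTheory.LatticeRep G, ∃ β₀ : ℝ, ∀ β : ℝ, β₀ ≤ β → (∀ A B : Literature.MathematicalPhysics.QuantumFieldTheory.YMSpecies G, ∀ ε : ℝ, 0 < ε → ∃ n₀ : ℕ, ∀ S n : ℕ, n₀ ≤ n → n ≤ S → |Literature.MathematicalPhysics.QuantumFieldTheory.latticeConnectedCorr r.ρ β (2 * S + 1) A.F B.F n| ≤ ε) → ∀ A B : Literature.MathematicalPhysics.QuantumFieldTheory.YMSpecies G, ∃ χ : ℝ, ∀ S : ℕ, ∑ x ∈ Literature.Probability.LatticeModels.box 4 S, |ProbabilityTheory.covariance (fun U =>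 A.F (Literature.MathematicalPhysics.QuantumLattice.torusLift (2 * S + 1) U)) (fun U => B.F (Literature.MathematicalPhysics.QuantumLattice.configShift (-x) (Literature.MathematicalPhysics.QuantumLattice.torusLift (2 * S + 1) U))) (Literature.MathematicalPhysics.QuantumFieldTheory.wilsonMeasure r.ρ β)| ≤ χ := by
  sorry

/-- Consistency of the c22 re-typing: the re-typed STUB 1 is, definitionally, the c16–c21 registration / item
stmt-QuantumFields-18061 verbatim (named-argument spelling of the Wilson measure). [folklore] -/
theorem retypedStub1_iff_item18061 :
    (∀ (G : Type) [Group G] [TopologicalSpace G] [IsTopologicalGroup G] [CompactSpace G] [MeasurableSpace G] [BorelSpace G], Literature.MathematicalPhysics.QuantumFieldTheory.IsCompactSimpleLieGroup G → ∀ r : Literature.MathematicalPhysics.QuantumFieldTheory.LatticeRep G, ∃ β₀ : ℝ, ∀ β : ℝ, β₀ ≤ β → (∀ A B : Literature.MathematicalPhysics.QuantumFieldTheory.YMSpecies G, ∀ ε : ℝ, 0 < ε → ∃ n₀ : ℕ, ∀ S n : ℕ, n₀ ≤ n → n ≤ S → |Literature.MathematicalPhysics.QuantumFieldTheory.latticeConnectedCorr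 r.ρ β (2 * S + 1) A.F B.F n| ≤ ε) → ∀ A B : Literature.MathematicalPhysics.QuantumFieldTheory.YMSpecies G, ∃ χ : ℝ, ∀ S : ℕ, ∑ x ∈ Literature.Probability.LatticeModels.box 4 S, |ProbabilityTheory.covariance (fun U => A.F (Literature.MathematicalPhysics.QuantumLattice.torusLift (2 * S + 1) U)) (fun U => B.F (Literature.MathematicalPhysics.QuantumLattice.configShift (-x) (Literature.MathematicalPhysics.QuantumLattice.torusLift (2 * S + 1) U))) (Literature.MathematicalPhysics.QuantumFieldTheory.wilsonMeasure r.ρ β)| ≤ χ)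
    ↔
    (∀ (G : Type) [Group G] [TopologicalSpace G] [IsTopologicalGroup G] [CompactSpace G] [MeasurableSpace G] [BorelSpace G], Literature.MathematicalPhysics.QuantumFieldTheory.IsCompactSimpleLieGroup G → ∀ r : Literature.MathematicalPhysics.QuantumFieldTheory.LatticeRep G, ∃ β₀ : ℝ, ∀ β : ℝ, β₀ ≤ β → (∀ A B : Literature.MathematicalPhysics.QuantumFieldTheory.YMSpecies G, ∀ ε : ℝ, 0 < ε → ∃ n₀ : ℕ, ∀ S n : ℕ, n₀ ≤ n → n ≤ S → |Literature.MathematicalPhysics.QuantumFieldTheory.latticeConnectedCorr r.ρ β (2 * S + 1) A.F B.F n| ≤ ε) → ∀ A B : Literature.MathematicalPhysics.QuantumFieldTheory.YMSpecies G, ∃ χ : ℝ, ∀ S : ℕ, ∑ x ∈ Literature.Probability.LatticeModels.box 4 S, |ProbabilityTheory.covariance (fun U => A.F (Literature.MathematicalPhysics.QuantumLattice.torusLift (2 * S + 1) U)) (fun U => B.F (Literature.MathematicalPhysics.QuantumLattice.configShift (-x) (Literature.MathematicalPhysics.QuantumLattice.torusLift (2 * S + 1) U))) (Literature.MathematicalPhysics.QuantumFieldTheory.wilsonMeasure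 (d := 4) (L := 2 * S + 1) r.ρ β)| ≤ χ) :=
  Iff.rfl

/-! ## §2 Consistency (each named statement IS its registered stub, definitionally) and name-keyed aliases -/

/-- Consistency: STUB 0′ is `NoEvenLongRangeOrder` (definitional). -/
theorem noEvenLongRangeOrder_holds : NoEvenLongRangeOrder := stub_noEvenLongRangeOrder
/-- Consistency: STUB 1 is `DecorrelationForcesSummability` (definitional). -/
theorem decorrelationForcesSummability_holds : DecorrelationForcesSummability :=
  stub_rateHalfDecorrelationForcesSummability

namespace Registered

/-- Alias of STUB 0′'s statement keyed by the registered stub name. -/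
abbrev stub_noEvenLongRangeOrder : Prop := NoEvenLongRangeOrder
/-- The old STUB 0 statement (c16–c19 registration), now DERIVED (§4′). -/
abbrev stub_noMirrorLongRangeOrder : Prop := NoMirrorLongRangeOrder
/-- Alias of STUB 1's statement keyed by the registered stub name (lead c23 rename). -/
abbrev stub_rateHalfDecorrelationForcesSummability : Prop := DecorrelationForcesSummability

end Registered

/-! ## §3 Proved glue: mirror decorrelation ⇒ all-pairs decorrelation (RP), at fixed `(G, r, β ≥ 0)` -/

section Glue

open Summit.QuantumFields.YangMills.Theorems.FiniteSusceptibilityWeakCoupling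
open Summit.QuantumFields.YangMills.Theorems.FiniteSusceptibilityWeakCoupling.MirrorDominationAxis0

variable {G : Type} [Group G] [TopologicalSpace G] [IsTopologicalGroup G] [CompactSpace G]
  [MeasurableSpace G] [BorelSpace G]

/-- **Mirror decorrelation ⇒ all-pairs decorrelation** (every compact `G`, every `β ≥ 0`): by the landed explicit-pair
mirror domination `MirrorFunnel.abs_cov_axial_le_mirror` — for `n₀(A,B) ≤ n ≤ S`,
`|Cov_S(A, τ_n B)| ≤ Σ_{j ≤ S, |j-n| ≤ 1} (|Cov_S(A, τ_j Aᴿ)| + |Cov_S(Aᴿ, τ_j A)| + |Cov_S(Bᴿ, τ_j B)|)` — the window has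
at most three lags, and the pairs `(Aᴿ, A) = (Aᴿ, (Aᴿ)ᴿ)`, `(Bᴿ, B)` are mirror pairs of the species `Aᴿ, Bᴿ`
(`reflSpecies`, `cfgReflect_cfgReflect`). [folklore] -/
theorem decorrelation_of_mirrorDecorrelation (r : LatticeRep G) {β : ℝ} (hβ : 0 ≤ β)
    (h : MirrorDecorrelationAt r β) : DecorrelationAt r β := by
  intro A B ε hε
  obtain ⟨n₁, hdom⟩ := MirrorFunnel.abs_cov_axial_le_mirror r hβ A B
  have hε9 : 0 < ε / 9 := by positivity
  obtain ⟨jA, hA⟩ := h A (ε / 9) hε9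
  obtain ⟨jA', hA'⟩ := h (reflSpecies A) (ε / 9) hε9
  obtain ⟨jB', hB'⟩ := h (reflSpecies B) (ε / 9) hε9
  have hRA : (reflSpecies A).F = fun V => A.F (cfgReflect V) := rfl
  have hRB : (reflSpecies B).F = fun V => B.F (cfgReflect V) := rfl
  have hA2 : ∀ S j : ℕ, jA' ≤ j → j ≤ S →
      |latticeConnectedCorr r.ρ β (2 * S + 1) (fun V => A.F (cfgReflect V)) A.F j| ≤ ε / 9 :=
    fun S j hj hjS => by simpa only [hRA, MirrorDominationAxis0.cfgReflect_cfgReflect] using hA' S j hj hjS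
  have hB2 : ∀ S j : ℕ, jB' ≤ j → j ≤ S →
      |latticeConnectedCorr r.ρ β (2 * S + 1) (fun V => B.F (cfgReflect V)) B.F j| ≤ ε / 9 :=
    fun S j hj hjS => by simpa only [hRB, MirrorDominationAxis0.cfgReflect_cfgReflect] using hB' S j hj hjS
  refine ⟨max n₁ (max jA (max jA' jB') + 1), fun S n hn hnS => ?_⟩
  have hn₁ : n₁ ≤ n := le_trans (le_max_left _ _) hn
  have hnj : max jA (max jA' jB') + 1 ≤ n := le_trans (le_max_right _ _) hn
  have key := hdom S n hn₁ hnS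
  rw [SiblingFunnel.covariance_eq_latticeConnectedCorr r β A B S n] at key
  have e0 : ∀ j : ℕ, cov[fun U => A.F (torusLift (2 * S + 1) U),
      fun U => A.F (cfgReflect (configShift (-(Pi.single 0 (j : ℤ))) (torusLift (2 * S + 1) U)));
      wilsonMeasure (d := 4) (L := 2 * S + 1) r.ρ β] =
      latticeConnectedCorr r.ρ β (2 * S + 1) A.F (fun V => A.F (cfgReflect V)) j :=
    fun j => SiblingFunnel.covariance_eq_latticeConnectedCorr r β A (reflSpecies A) S j
  have e1 : ∀ j : ℕ, cov[fun U => A.F (cfgReflect (torusLift (2 * S + 1) U)),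
      fun U => A.F (configShift (-(Pi.single 0 (j : ℤ))) (torusLift (2 * S + 1) U));
      wilsonMeasure (d := 4) (L := 2 * S + 1) r.ρ β] =
      latticeConnectedCorr r.ρ β (2 * S + 1) (fun V => A.F (cfgReflect V)) A.F j :=
    fun j => SiblingFunnel.covariance_eq_latticeConnectedCorr r β (reflSpecies A) A S j
  have e2 : ∀ j : ℕ, cov[fun U => B.F (cfgReflect (torusLift (2 * S + 1) U)),
      fun U => B.F (configShift (-(Pi.single 0 (j : ℤ))) (torusLift (2 * S + 1) U));
      wilsonMeasure (d := 4) (L := 2 * S + 1) r.ρ β] =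
      latticeConnectedCorr r.ρ β (2 * S + 1) (fun V => B.F (cfgReflect V)) B.F j :=
    fun j => SiblingFunnel.covariance_eq_latticeConnectedCorr r β (reflSpecies B) B S j
  simp only [e0, e1, e2] at key
  set W := (range (S + 1)).filter (fun j => n ≤ j + 1 ∧ j ≤ n + 1) with hW
  have hterm : ∀ j ∈ W,
      |latticeConnectedCorr r.ρ β (2 * S + 1) A.F (fun V => A.F (cfgReflect V)) j| +
        |latticeConnectedCorr r.ρ β (2 * S + 1) (fun V => A.F (cfgReflect V)) A.F j| +
        |latticeConnectedCorr r.ρ β (2 * S + 1) (fun V => B.F (cfgReflect V)) B.F j| ≤ ε / 3 := by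
    intro j hj
    rw [hW, mem_filter, mem_range] at hj
    have hjS : j ≤ S := by omega
    have hmax : max jA (max jA' jB') ≤ j := by omega
    have a1 := hA S j (le_trans (le_max_left _ _) hmax) hjS
    have a2 := hA2 S j (le_trans (le_trans (le_max_left _ _) (le_max_right _ _)) hmax) hjS
    have b2 := hB2 S j (le_trans (le_trans (le_max_right _ _) (le_max_right _ _)) hmax) hjS
    linarith
  have hcard : W.card ≤ 3 := by
    calc W.card ≤ (Icc (n - 1) (n + 1)).card := by
          refine card_le_card fun j hj => ?_
          rw [hW, mem_filter, mem_range] at hj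
          rw [mem_Icc]; omega
      _ = 3 := by rw [Nat.card_Icc]; omega
  calc |latticeConnectedCorr r.ρ β (2 * S + 1) A.F B.F n|
      ≤ ∑ j ∈ W, (|latticeConnectedCorr r.ρ β (2 * S + 1) A.F (fun V => A.F (cfgReflect V)) j| +
          |latticeConnectedCorr r.ρ β (2 * S + 1) (fun V => A.F (cfgReflect V)) A.F j| +
          |latticeConnectedCorr r.ρ β (2 * S + 1) (fun V => B.F (cfgReflect V)) B.F j|) := key
    _ ≤ ∑ _j ∈ W, ε / 3 := sum_le_sum hterm
    _ = W.card * (ε / 3) := by rw [sum_const, nsmul_eq_mul]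
    _ ≤ 3 * (ε / 3) := by
          have h3 : (W.card : ℝ) ≤ 3 := by exact_mod_cast hcard
          exact mul_le_mul_of_nonneg_right h3 (by positivity)
    _ = ε := by ring

/-- The converse bookkeeping: all-pairs decorrelation contains the mirror pairs (`B := Aᴿ`). [folklore] -/
theorem mirrorDecorrelation_of_decorrelation (r : LatticeRep G) (β : ℝ) (h : DecorrelationAt r β) :
    MirrorDecorrelationAt r β :=
  fun A ε hε => h A (reflSpecies A) ε hε

/-- **STUB 0's terms are eventually non-negative** (every compact `G`, `β ≥ 0`; landed `MirrorPositivity`): beyond the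
support scale `n₂(A)`, `0 ≤ ⟨A·τ_j(A∘Θ)⟩ − ⟨A⟩⟨A∘Θ⟩` for all `j ≤ S` — so STUB 0 asks that a NON-NEGATIVE order
parameter tend to zero, uniformly in the volume. [folklore] -/
theorem stub0_terms_nonneg_eventually (r : LatticeRep G) {β : ℝ} (hβ : 0 ≤ β) (A : YMSpecies G) :
    ∃ n₂ : ℕ, ∀ S j : ℕ, n₂ ≤ j → j ≤ S →
      0 ≤ latticeConnectedCorr r.ρ β (2 * S + 1) A.F (fun V => A.F (cfgReflect V)) j :=
  mirrorCorr_nonneg_eventually r hβ A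

/-- **Every exponential time-clustering leg gives STUB 0's clause** (fixed `(G, r, β)`): `C e^{-mn} ≤ ε` for large
`n`, the volume threshold `S₀ ≤ S` being met because `n ≤ S`. So STUB 0 is weaker than every lattice-gap leg
8778 / 8761 / 8901 / 8715. [folklore] -/
theorem decorrelationAt_of_clusteringAt (r : LatticeRep G) (β : ℝ) {m : ℝ} (hm : 0 < m)
    (hAB : ∀ A B : YMSpecies G, ∃ (C : ℝ) (S₀ : ℕ), ∀ S : ℕ, S₀ ≤ S → ∀ n : ℕ, n ≤ S →
        |latticeConnectedCorr r.ρ β (2 * S + 1) A.F B.F n| ≤ C * Real.exp (-(m * n))) :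
    DecorrelationAt r β := by
  intro A B ε hε
  obtain ⟨C, S₀, hC⟩ := hAB A B
  obtain ⟨N, hN⟩ : ∃ N : ℕ, ∀ n : ℕ, N ≤ n → C * Real.exp (-(m * n)) ≤ ε := by
    have ht : Filter.Tendsto (fun n : ℕ => C * Real.exp (-(m * n))) Filter.atTop (nhds (C * 0)) := by
      refine Filter.Tendsto.const_mul C ?_
      have h1 : Filter.Tendsto (fun n : ℕ => m * (n : ℝ)) Filter.atTop Filter.atTop :=
        Filter.Tendsto.const_mul_atTop hm tendsto_natCast_atTop_atTop
      exact Real.tendsto_exp_neg_atTop_nhds_zero.comp h1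
    rw [mul_zero] at ht
    obtain ⟨N, hN⟩ := (Filter.tendsto_atTop'.1 ht) (Set.Iic ε) (Iic_mem_nhds hε)
    exact ⟨N + 1, fun n hn => hN n (by omega)⟩
  refine ⟨max N S₀, fun S n hn hnS => ?_⟩
  have hS : S₀ ≤ S := le_trans (le_trans (le_max_right _ _) hn) hnS
  exact (hC S hS n hnS).trans (hN n (le_trans (le_max_left _ _) hn))

end Glue

/-! ## §4′ (lead c20) STUB 0′ ⇒ STUB 0: the even sector is all of the purity half -/

section EvenReduction

open Summit.QuantumFields.YangMills.Theorems.FiniteSusceptibilityWeakCoupling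

variable {G : Type} [Group G] [TopologicalSpace G] [IsTopologicalGroup G] [CompactSpace G]
  [MeasurableSpace G] [BorelSpace G]

/-- **Even-sector decorrelation ⇒ mirror decorrelation of EVERY species** at fixed `(G, r, β ≥ 0)`: apply
`stub_noMirrorLRO_of_even` to `(A, A⁺, A⁻)` — `A⁺ = SpeciesParity.symSpecies A` is even (`SpeciesParity.symSpecies_even`, landed `Theorems/…SpeciesParity.lean` p144906), so STUB 0′ at `β` supplies its
time-axis decorrelation. -/
theorem mirrorDecorrelation_of_evenDecorrelation (r : LatticeRep G) {β : ℝ} (hβ : 0 ≤ β)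
    (h : EvenDecorrelationAt r β) : MirrorDecorrelationAt r β := fun A ε hε =>
  stub_noMirrorLRO_of_even G r β hβ A (SpeciesParity.symSpecies A) (SpeciesParity.antiSpecies A)
    (SpeciesParity.symSpecies_F A) (SpeciesParity.antiSpecies_F A)
    (h (SpeciesParity.symSpecies A) (SpeciesParity.symSpecies_even A)) ε hε

/-- The converse bookkeeping at fixed `(G, r, β)`: for an even species the mirror correlator IS the plain autocorrelation. -/
theorem evenDecorrelation_of_mirrorDecorrelation (r : LatticeRep G) (β : ℝ) (h : MirrorDecorrelationAt r β) :
    EvenDecorrelationAt r β := by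
  intro A hA ε hε
  obtain ⟨j₀, hj₀⟩ := h A ε hε
  refine ⟨j₀, fun S j hj hjS => ?_⟩
  have hF : (fun V => A.F (cfgReflect V)) = A.F := funext hA
  simpa only [hF] using hj₀ S j hj hjS

end EvenReduction

/-- **STUB 0′ ⇒ STUB 0** (`β₀ ↦ max β₀ 0`). -/
theorem noMirrorLongRangeOrder_of_even (h : Registered.stub_noEvenLongRangeOrder) : NoMirrorLongRangeOrder := by
  intro G _ _ _ _ _ _ hG r
  obtain ⟨β₀, hβ₀⟩ := h G hG r
  refine ⟨max β₀ 0, fun β hβ => ?_⟩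
  exact mirrorDecorrelation_of_evenDecorrelation r ((le_max_right _ _).trans hβ) (hβ₀ β ((le_max_left _ _).trans hβ))

/-- **STUB 0 ⇒ STUB 0′** (even species are species). -/
theorem noEvenLongRangeOrder_of_noMirror (h : NoMirrorLongRangeOrder) : NoEvenLongRangeOrder := by
  intro G _ _ _ _ _ _ hG r
  obtain ⟨β₀, hβ₀⟩ := h G hG r
  exact ⟨β₀, fun β hβ => evenDecorrelation_of_mirrorDecorrelation r β (hβ₀ β hβ)⟩

/-- The old registered STUB 0, now a CONSEQUENCE of STUB 0′ and the four c20 stubs. -/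
theorem noMirrorLongRangeOrder_holds : NoMirrorLongRangeOrder := noMirrorLongRangeOrder_of_even stub_noEvenLongRangeOrder

/-! ## §4 The composition: the two stubs imply the crux, BY NAME -/

/-- `FiniteSusceptibilityWeakCoupling` from the two OPEN stub STATEMENTS STUB 0′ and STUB 1 (pure logic on top of §3–§4′, whose
four c20 stubs are landed theorems): STUB 0′ at `β ≥ max β₀⁰ (max β₀¹ 0)` gives
even-sector decorrelation, §4′ turns it into mirror decorrelation of every species, §3 into all-pairs decorrelation (`β ≥ 0`),
STUB 1 into the crux's clause at `β`. -/
theorem finiteSusceptibilityWeakCoupling_of_stubs (h₀ : Registered.stub_noEvenLongRangeOrder)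
    (h₁ : Registered.stub_rateHalfDecorrelationForcesSummability) :
    Summit.QuantumFields.YangMills.Theses.FradkinShenkerFlow.FiniteSusceptibilityWeakCoupling := by
  intro G _ _ _ _ _ _ hG r
  obtain ⟨β₀, hβ₀⟩ := noMirrorLongRangeOrder_of_even h₀ G hG r
  obtain ⟨β₁, hβ₁⟩ := h₁ G hG r
  refine ⟨max β₀ (max β₁ 0), fun β hβ => ?_⟩
  have h0 : (0 : ℝ) ≤ β := le_trans (le_trans (le_max_right _ _) (le_max_right _ _)) hβ
  have hb₀ : β₀ ≤ β := le_trans (le_max_left _ _) hβ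
  have hb₁ : β₁ ≤ β := le_trans (le_trans (le_max_left _ _) (le_max_right _ _)) hβ
  exact hβ₁ β hb₁ (decorrelation_of_mirrorDecorrelation r h0 (hβ₀ β hb₀))

/-- **The skeleton theorem: the crux decl BY NAME, no hypotheses, `sorry` entering only through the registered
`stub_*`.** -/
theorem FiniteSusceptibilityWeakCoupling_of :
    Summit.QuantumFields.YangMills.Theses.FradkinShenkerFlow.FiniteSusceptibilityWeakCoupling :=
  finiteSusceptibilityWeakCoupling_of_stubs stub_noEvenLongRangeOrder stub_rateHalfDecorrelationForcesSummability

/-! ## §5 Sanity: the crux gives STUB 1 (so STUB 1 is weaker than the crux); STUB 0 is weaker than every gap leg (§3) -/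

/-- The crux implies STUB 1 (a clause that holds outright holds under any hypothesis). [folklore] -/
theorem decorrelationForcesSummability_of_crux
    (h : Summit.QuantumFields.YangMills.Theses.FradkinShenkerFlow.FiniteSusceptibilityWeakCoupling) :
    DecorrelationForcesSummability := by
  intro G _ _ _ _ _ _ hG r
  obtain ⟨β₀, hβ₀⟩ := h G hG r
  exact ⟨β₀, fun β hβ _ => hβ₀ β hβ⟩


/-! ## §6 The cut is lossless (lead c16): the two registered stubs are together EQUIVALENT to the crux -/

/-- The crux implies STUB 0 (landed `noMirrorLongRangeOrder_of_finiteSusceptibility`, `Theorems/…MirrorMonotone.lean`: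
reflection positivity ⇒ monotone symmetrised mirror function ⇒ ℓ¹ forces decorrelation). [folklore] -/
theorem noMirrorLongRangeOrder_of_crux
    (h : Summit.QuantumFields.YangMills.Theses.FradkinShenkerFlow.FiniteSusceptibilityWeakCoupling) :
    NoMirrorLongRangeOrder :=
  Summit.QuantumFields.YangMills.Theorems.FiniteSusceptibilityWeakCoupling.noMirrorLongRangeOrder_of_finiteSusceptibility h

/-- **`crux ↔ STUB 0′ ∧ STUB 1`** (lead c16, reshaped c20): the line's decomposition is an equivalence — the purity half of
the crux is exactly "no long-range order in the reflection-EVEN sector at weak coupling" (`→`: landed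
`noMirrorLongRangeOrder_of_finiteSusceptibility` restricted to even species, and §5; `←`: §4, through the four c20 stubs).
The c16–c19 form `crux ↔ NoMirrorLongRangeOrder ∧ DecorrelationForcesSummability` is the landed
`…MirrorMonotone.finiteSusceptibilityWeakCoupling_iff_subs` / `…Split.finiteSusceptibilityWeakCoupling_of_subs` together with
`noMirrorLongRangeOrder_of_even` / `noEvenLongRangeOrder_of_noMirror` (§4′). [folklore] -/
theorem crux_iff_stubs :
    Summit.QuantumFields.YangMills.Theses.FradkinShenkerFlow.FiniteSusceptibilityWeakCoupling ↔
      (Registered.stub_noEvenLongRangeOrder ∧ Registered.stub_rateHalfDecorrelationForcesSummability) :=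
  ⟨fun h => ⟨noEvenLongRangeOrder_of_noMirror (noMirrorLongRangeOrder_of_crux h), decorrelationForcesSummability_of_crux h⟩,
    fun h => finiteSusceptibilityWeakCoupling_of_stubs h.1 h.2⟩

/-- The same equivalence as a LANDED tree theorem (`Theorems/…SpeciesParity.lean`, p144906, registered `stub_cruxIffEvenSubs`):
`crux ↔ NoEvenLongRangeOrder ∧ DecorrelationForcesSummability`, both conjuncts spelled out. [folklore] -/
theorem crux_iff_stubs_tree :
    Summit.QuantumFields.YangMills.Theses.FradkinShenkerFlow.FiniteSusceptibilityWeakCoupling ↔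
      (Registered.stub_noEvenLongRangeOrder ∧ Registered.stub_rateHalfDecorrelationForcesSummability) :=
  Summit.QuantumFields.YangMills.Theorems.FiniteSusceptibilityWeakCoupling.stub_cruxIffEvenSubs

/-! ## §7 Where simplicity enters STUB 1 (lead c18): the landed G-entry lemmas of the rate half

STUB 1 is false with simplicity deleted (`U(1)₄`): there the `C`-odd plaquette observable `sin θ_p` IS the field strength
and its two-point function decays like `|x|⁻⁴`, not summable in `d = 4`. For simple `G` that single-plaquette mechanism is
absent. Three registered stubs, all LANDED under `Theorems/` (`--supports stmt-QuantumFields-9442`), record where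
`IsCompactSimpleLieGroup` enters: no continuous character (`det ∘ r.ρ ≡ 1`), hence the `C`-odd Wilson character of a
plaquette variable is `O((action density)^{3/2})`, while the `C`-even part is exactly quadratic for EVERY compact `G`.
They do not lower this file's sorry count (STUB 0 / STUB 1 are open-problem-sized); they are the typed entry point for the
chain that will attack STUB 1 (idea card `semisimple-quadratic-onset`, its two lemmas, now kernel-checked). -/

section GEntry

/-- G-entry (i) — landed `stub_simpleRepDetOne` (p140546): a compact simple `G` has no non-trivial continuous character,
so every lattice representation lands in `SU(r.N)`. [folklore] -/
theorem gEntry_det_eq_one {G : Type} [Group G] [TopologicalSpace G] [IsTopologicalGroup G] [CompactSpace G]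
    (hG : IsCompactSimpleLieGroup G) (r : LatticeRep G) (g : G) : (r.ρ g).det = 1 :=
  Summit.QuantumFields.YangMills.Theorems.FiniteSusceptibilityWeakCoupling.stub_simpleRepDetOne G hG r g

/-- G-entry (ii) — landed `stub_oddTraceActionBound` (p140993): on `SU(N)` the `C`-odd character `Im tr V` is bounded
super-linearly (power `3/2`) by the Wilson action density `N - Re tr V`. [folklore] -/
theorem gEntry_oddTrace (N : ℕ) : ∃ C : ℝ, ∀ V : Matrix (Fin N) (Fin N) ℂ, V ∈ Matrix.unitaryGroup (Fin N) ℂ →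
    V.det = 1 → |V.trace.im| ≤ C * ((N : ℝ) - V.trace.re) ^ ((3 : ℝ) / 2) :=
  Summit.QuantumFields.YangMills.Theorems.FiniteSusceptibilityWeakCoupling.stub_oddTraceActionBound N

/-- G-entry (iii) — landed `stub_plaquetteCharacterOnset` (p141395): the composition in the route's vocabulary — for
compact simple `G` and `r : LatticeRep G`, `|Im tr (r.ρ g)| ≤ C (r.N - Re tr (r.ρ g))^{3/2}` uniformly in `g`. [folklore] -/
theorem gEntry_plaquetteCharacterOnset {G : Type} [Group G] [TopologicalSpace G] [IsTopologicalGroup G]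
    [CompactSpace G] (hG : IsCompactSimpleLieGroup G) (r : LatticeRep G) :
    ∃ C : ℝ, ∀ g : G, |(r.ρ g).trace.im| ≤ C * ((r.N : ℝ) - (r.ρ g).trace.re) ^ ((3 : ℝ) / 2) :=
  Summit.QuantumFields.YangMills.Theorems.FiniteSusceptibilityWeakCoupling.stub_plaquetteCharacterOnset G hG r

/-- The `C`-even companion (group-blind) — landed `plaquette_frobenius_sq`: the Wilson action density of a plaquette
variable is half its squared Frobenius distance to the identity, `∑ᵢⱼ |(r.ρ g - 1)ᵢⱼ|² = 2 (r.N - Re tr (r.ρ g))`. [folklore] -/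
theorem gEntry_frobenius_sq {G : Type} [Group G] [TopologicalSpace G] (r : LatticeRep G) (g : G) :
    ∑ i, ∑ j, Complex.normSq ((r.ρ g - 1) i j) = 2 * ((r.N : ℝ) - (r.ρ g).trace.re) :=
  Summit.QuantumFields.YangMills.Theorems.FiniteSusceptibilityWeakCoupling.plaquette_frobenius_sq r g

end GEntry

/-! ## §8 The spatial-parity cut of STUB 0′ (lead c21; strategist gen-2 §D5): NoEvenLRO ⟺ NoAxisEvenLRO ∧ EvenOddDirectionTransfer

Landed this seat under `Theorems/` (`--supports stmt-QuantumFields-9442`), every compact `G`, every real `β`: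
`stub_axisReflectionsCommute` (…AxisReflections: the four axis reflections `θ_k V := configPermZd (swap 0 k) (cfgReflect (configPermZd (swap 0 k) V))`
commute and are involutions), `stub_spatialReflectionSelectionRule` (…SelectionRule: the torus Wilson state is `θ_k`-invariant and `θ_k` commutes
with time translations, so `θ_k`-even ⊥ `θ_k`-odd in `latticeConnectedCorr`, `k ≠ 0`), `stub_connectedCorrPolarisation` (…Polarisation),
`stub_axisOddSpeciesSummable` (…AxisOddSummable: SPATIAL lattice Vafa–Witten — a `θ_k`-odd species has `β`-uniformly `ℓ¹` autocorrelation along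
its own axis `e_k`), `stub_noEvenLRO_iff_axisParity` (…AxisParity: `4·c_A = c_{A+A∘θ_k} + c_{A−A∘θ_k}` and the kernel-checked cut), and the
strategist's curried glue `stub_cruxOfEvenSubs` (…EvenSplit: `finiteSusceptibilityWeakCoupling_of_even_subs : 18060 → 18061 → crux`).
STUB 0′ (= item stmt-QuantumFields-18060) therefore splits, LOSSLESSLY, into
* P1 `NoAxisEvenLongRangeOrder`: the clause of STUB 0′ for the species even under ALL FOUR axis reflections (where the real enemies live:
  energy-like coexistence, nematic / transposition breaking, outer automorphisms, density waves — STRATEGY-CENSUS §S⁺8/§N9);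
* P2 `EvenOddDirectionTransfer`: the clause of STUB 0′ for the `Θ`-even species ODD under some spatial `θ_k` — "long-range order is
  direction-blind": such a species is `β`-uniformly `ℓ¹` along `e_k` (`stub_axisOddSpeciesSummable`), `≥ 0` and non-increasing along `e₀`
  beyond its support scale (RP: `MirrorLogConvex.mirrorCorr_nonneg`, `MirrorMonotone`), and P2 asks that it also decorrelate along `e₀`.
Neither piece is registered as a stub of THIS skeleton (third layer; they are lines for 18060's own chain): the sorry count stays 2. -/

section AxisParity

/-- **STUB 0′ ⟺ P1 ∧ P2** (pointer to the landed `stub_noEvenLRO_iff_axisParity`; P1, P2 written out). [folklore] -/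
theorem stub0'_iff_axisParity :
    Registered.stub_noEvenLongRangeOrder ↔
    ((∀ (G : Type) [Group G] [TopologicalSpace G] [IsTopologicalGroup G] [CompactSpace G] [MeasurableSpace G] [BorelSpace G],
      IsCompactSimpleLieGroup G → ∀ r : LatticeRep G, ∃ β₀ : ℝ, ∀ β : ℝ, β₀ ≤ β →
      ∀ A : YMSpecies G, (∀ V, A.F (cfgReflect V) = A.F V) →
        (∀ k : Fin 4, k ≠ 0 → ∀ V, A.F (configPermZd (Equiv.swap 0 k) (cfgReflect (configPermZd (Equiv.swap 0 k) V))) = A.F V) →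
        ∀ ε : ℝ, 0 < ε → ∃ j₀ : ℕ, ∀ S j : ℕ, j₀ ≤ j → j ≤ S → |latticeConnectedCorr r.ρ β (2 * S + 1) A.F A.F j| ≤ ε) ∧
     (∀ (G : Type) [Group G] [TopologicalSpace G] [IsTopologicalGroup G] [CompactSpace G] [MeasurableSpace G] [BorelSpace G],
      IsCompactSimpleLieGroup G → ∀ r : LatticeRep G, ∃ β₀ : ℝ, ∀ β : ℝ, β₀ ≤ β →
      ∀ k : Fin 4, k ≠ 0 → ∀ A : YMSpecies G, (∀ V, A.F (cfgReflect V) = A.F V) →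
        (∀ V, A.F (configPermZd (Equiv.swap 0 k) (cfgReflect (configPermZd (Equiv.swap 0 k) V))) = -A.F V) →
        ∀ ε : ℝ, 0 < ε → ∃ j₀ : ℕ, ∀ S j : ℕ, j₀ ≤ j → j ≤ S → |latticeConnectedCorr r.ρ β (2 * S + 1) A.F A.F j| ≤ ε)) :=
  Summit.QuantumFields.YangMills.Theorems.FiniteSusceptibilityWeakCoupling.stub_noEvenLRO_iff_axisParity

-- (The composition "P1 ∧ P2 ∧ STUB 1 ⇒ crux" is `finiteSusceptibilityWeakCoupling_of_stubs (stub0'_iff_axisParity.2 ⟨hP1, hP2⟩) h₁`;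
-- it is not stated as a theorem here because P1, P2 are not registered stubs of this skeleton.)

/-- **Spatial lattice Vafa–Witten** (pointer to the landed `stub_axisOddSpeciesSummable`): a `θ_k`-odd species is `β`-uniformly `ℓ¹` along `e_k`,
every compact `G` — so the P2 species decorrelate along their own axis at every `β ≥ 0`; P2 asks for the time axis. [folklore] -/
theorem axisOdd_summable_along_own_axis {G : Type} [Group G] [TopologicalSpace G] [IsTopologicalGroup G] [CompactSpace G]
    [MeasurableSpace G] [BorelSpace G] (r : LatticeRep G) (k : Fin 4) (A : YMSpecies G)
    (hodd : ∀ V, A.F (configPermZd (Equiv.swap 0 k) (cfgReflect (configPermZd (Equiv.swap 0 k) V))) = -A.F V) :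
    ∃ C : ℝ, ∀ β : ℝ, 0 ≤ β → ∀ S : ℕ, ∑ n ∈ Finset.range (2 * S + 1),
      |cov[fun U => A.F (torusLift (2 * S + 1) U), fun U => A.F (configShift (-(Pi.single k (n : ℤ))) (torusLift (2 * S + 1) U));
        wilsonMeasure (d := 4) (L := 2 * S + 1) r.ρ β]| ≤ C :=
  Summit.QuantumFields.YangMills.Theorems.FiniteSusceptibilityWeakCoupling.stub_axisOddSpeciesSummable G r k A hodd

end AxisParity

/-! ## §9 The charge-conjugation / automorphism sector (lead c28; STRATEGY-CENSUS §S⁺8, §N9(c), §N10)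

Landed this seat under `Theorems/` (`--supports stmt-QuantumFields-9442`): `…SU2ConjugationEven`, `…AutomorphismSector`, `…AutParity`,
`…AutSectorClause` (registered stubs `stub_su2SpeciesConjEven`, `stub_automorphismSelectionRule`, `stub_evenClause_iff_autParity`,
`stub_fsClause_iff_autParity`). For an involutive bi-continuous automorphism `φ` of `G` that preserves the Wilson character of `r`
(charge conjugation `g ↦ ḡ` of `SU(N)` with the fundamental action, `AutSector.exists_suConj`), both halves of the crux cut LOSSLESSLY
at fixed `(G, r, β)` into a `φ`-even and a `φ`-odd sector; for `SU(2)` the odd sector is empty. Pointers only (no stub of this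
skeleton changes; sorry count 2). -/

section AutSector

open Summit.QuantumFields.YangMills.Theorems.FiniteSusceptibilityWeakCoupling

/-- **`SU(2)` has no `C`-odd local sector** (pointer to the landed `stub_su2SpeciesConjEven`): every species of `SU(2)` lattice gauge
theory takes the same value on a configuration and on its link-wise complex conjugate. [folklore] -/
theorem su2_noOddSector (A : YMSpecies (Matrix.specialUnitaryGroup (Fin 2) ℂ))
    (U V : LGConfig 4 (Matrix.specialUnitaryGroup (Fin 2) ℂ))
    (hV : ∀ e, (V e : Matrix (Fin 2) (Fin 2) ℂ) = (U e : Matrix (Fin 2) (Fin 2) ℂ).map star) : A.F V = A.F U :=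
  stub_su2SpeciesConjEven A U V hV

/-- **Charge conjugation of `SU(N)` is an admissible involutive automorphism** (pointer to the landed `AutSector.exists_suConj`). [folklore] -/
theorem suConj_admissible (N : ℕ) :
    ∃ φ : Matrix.specialUnitaryGroup (Fin N) ℂ ≃* Matrix.specialUnitaryGroup (Fin N) ℂ,
      Continuous φ ∧ Continuous φ.symm ∧ Function.Involutive φ ∧
      (∀ g, (φ g : Matrix (Fin N) (Fin N) ℂ) = (g : Matrix (Fin N) (Fin N) ℂ).map star) ∧
      ∀ g, ((fundamentalRep (Fin N) (φ g)).trace).re = ((fundamentalRep (Fin N) g).trace).re :=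
  AutSector.exists_suConj N

variable {G : Type} [Group G] [TopologicalSpace G] [IsTopologicalGroup G] [CompactSpace G]
  [MeasurableSpace G] [BorelSpace G]

/-- **Selection rule** (pointer to the landed `stub_automorphismSelectionRule`): `φ`-even ⊥ `φ`-odd in the connected time-correlator,
every compact `G`, every real `β`, every character-preserving bi-continuous automorphism `φ`. [folklore] -/
theorem autSelectionRule (r : LatticeRep G) (β : ℝ) (φ : G ≃* G) (hφ : Continuous φ) (hφs : Continuous φ.symm)
    (hρφ : ∀ g, (r.ρ (φ g)).trace.re = (r.ρ g).trace.re) (P M : YMSpecies G)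
    (hP : ∀ V, P.F (fun e => φ (V e)) = P.F V) (hM : ∀ V, M.F (fun e => φ (V e)) = -M.F V) (S n : ℕ) :
    latticeConnectedCorr r.ρ β (2 * S + 1) P.F M.F n = 0 ∧ latticeConnectedCorr r.ρ β (2 * S + 1) M.F P.F n = 0 :=
  stub_automorphismSelectionRule G r β φ hφ hφs hρφ P M hP hM S n

/-- **STUB 0′'s clause cuts along `φ`** (pointer to the landed `stub_evenClause_iff_autParity`, in the §0 vocabulary):
`EvenDecorrelationAt r β` iff its restrictions to the `φ`-even and to the `φ`-odd `Θ`-even species. [folklore] -/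
theorem evenDecorrelationAt_iff_autParity (r : LatticeRep G) (β : ℝ) (φ : G ≃* G) (hφ : Continuous φ)
    (hφs : Continuous φ.symm) (hφ2 : Function.Involutive φ) (hρφ : ∀ g, (r.ρ (φ g)).trace.re = (r.ρ g).trace.re) :
    EvenDecorrelationAt r β ↔
      ((∀ A : YMSpecies G, (∀ V, A.F (cfgReflect V) = A.F V) → (∀ V, A.F (fun e => φ (V e)) = A.F V) →
          ∀ ε : ℝ, 0 < ε → ∃ j₀ : ℕ, ∀ S j : ℕ, j₀ ≤ j → j ≤ S → |latticeConnectedCorr r.ρ β (2 * S + 1) A.F A.F j| ≤ ε) ∧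
        (∀ A : YMSpecies G, (∀ V, A.F (cfgReflect V) = A.F V) → (∀ V, A.F (fun e => φ (V e)) = -A.F V) →
          ∀ ε : ℝ, 0 < ε → ∃ j₀ : ℕ, ∀ S j : ℕ, j₀ ≤ j → j ≤ S → |latticeConnectedCorr r.ρ β (2 * S + 1) A.F A.F j| ≤ ε)) :=
  stub_evenClause_iff_autParity G r β φ hφ hφs hφ2 hρφ

/-- **The crux's clause cuts along `φ`** (pointer to the landed `stub_fsClause_iff_autParity`, in the §0 vocabulary):
`FSClauseAt r β` iff its restrictions to the `(φ-even, φ-even)` and to the `(φ-odd, φ-odd)` pairs of species. [folklore] -/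
theorem fsClauseAt_iff_autParity (r : LatticeRep G) (β : ℝ) (φ : G ≃* G) (hφ : Continuous φ)
    (hφs : Continuous φ.symm) (hφ2 : Function.Involutive φ) (hρφ : ∀ g, (r.ρ (φ g)).trace.re = (r.ρ g).trace.re) :
    FSClauseAt r β ↔
      ((∀ A B : YMSpecies G, (∀ V, A.F (fun e => φ (V e)) = A.F V) → (∀ V, B.F (fun e => φ (V e)) = B.F V) →
          ∃ χ : ℝ, ∀ S : ℕ, ∑ x ∈ box 4 S, |cov[fun U => A.F (torusLift (2 * S + 1) U),
            fun U => B.F (configShift (-x) (torusLift (2 * S + 1) U)); wilsonMeasure (d := 4) (L := 2 * S + 1) r.ρ β]| ≤ χ) ∧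
        (∀ A B : YMSpecies G, (∀ V, A.F (fun e => φ (V e)) = -A.F V) → (∀ V, B.F (fun e => φ (V e)) = -B.F V) →
          ∃ χ : ℝ, ∀ S : ℕ, ∑ x ∈ box 4 S, |cov[fun U => A.F (torusLift (2 * S + 1) U),
            fun U => B.F (configShift (-x) (torusLift (2 * S + 1) U)); wilsonMeasure (d := 4) (L := 2 * S + 1) r.ρ β]| ≤ χ)) :=
  stub_fsClause_iff_autParity G r β φ hφ hφs hφ2 hρφ

end AutSector

end Summit.QuantumFields.YangMills.Cruxes.FiniteSusceptibilityWeakCoupling.PurityRateSplit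

end
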